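import Summits.HodgeConjecture.HodgeCM.Model.TowerCarrier
import HarnessLib

/-!
# FLOOR-0 P4, stub T2b — COMPLEX CONJUGATION ON THE HodgeCM TOWER `H = colim_K H¹(X_K(ℂ); ℂ)`

Cell hodgecm-mathlib (D-0151), FLOOR 0, crux item H413 = stmt-HodgeConjecture-24833; programme P4, planner line of record
`Cruxes/H413/Lines/F0-P4AdmissibleOccursInH1.lean` (F0P4-plan (g0), sha16 98373f7d, director s341), stub `stub_T2b_towerConjugationAt`
(«complex conjugation on the pin's tower module, Hodge-disjoint from the `(1,0)`-part»).  Author A-p19 (g15).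
`--supports stmt-HodgeConjecture-24833 --as helper`.

Binder-1's tower (`Model/TowerLevel_1`, `Model/TowerCarrier`) is `Tower … V = Module.DirectLimit` over the levels `Γ` below a conjugate of
`K_f(3)` of the level carriers `towerLevel Γ hΓ ⊆ Π h, H¹(X_{Γ^h}; ℂ)` (families compatible with the rational translates `t_γ^*`), with
`H¹(X; ℂ) = ℂ ⊗_ℚ H¹(X; ℚ)` (`Universe.CohC`).  Every structure map of the tower — `trPull`, `restrictLevel`, `castLevel`, `translate`,
`res`, hence `ofLevel` and `act` — is COMPONENTWISE A BASE-CHANGED `ℚ`-LINEAR MAP (`Universe.pullC f k = (U.pull f k).baseChange ℂ`), so the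
real structure `conj ⊗ id` (★ `HodgeStructure.conj`, `conj_baseChange`) passes through all of them.  This file proves exactly that, generically in
the universe records `hHD hI hU h₃ hA` (as binder-1 does):

* §1 `conjL Γ hΓ : towerLevel Γ hΓ →ₛₗ[starRingEnd ℂ] towerLevel Γ hΓ` (componentwise `conj ⊗ id`), an involution commuting with
  `restrictLevel` / `castLevel` / `translate` / `res`; the sub-space `H10L Γ hΓ` of families with all components in `F¹` is preserved by
  `restrictLevel` (★ `Fact_pull_hodge` of the model universe, `universeOf_modelAxiomsPerL`), and a family in `H10L` whose conjugate is again
  in `H10L` vanishes (opposedness ★ `HodgeStructure.isCompl_F_complexConj 1 1` in weight one);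
* §2 `conjT : Tower … V →ₛₗ[starRingEnd ℂ] Tower … V`, the conjugate-linear endomorphism of the `Module.DirectLimit` induced by the `conjL`
  (built with `AddCon.lift` on Mathlib's presentation `Module.DirectLimit G f = (DirectLimit.moduleCon f).Quotient`, the same two lines as
  Mathlib's `Module.DirectLimit.lift` — a conjugate-linear map out of a direct limit is not a stock construction), with `conjT_ofLevel`,
  `conjT_conjT` (hence `conjT_injective`) and `conjT_act` (it commutes with the Hecke action `act g`, because `translate` is componentwise `t_1^*`);
* §3 the `(1,0)`-part of the tower `H10T = ⨆_j (H10L j).map (ofLevel j)` is a DIRECTED union (`H10T_mono`), and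
  **`eq_zero_of_mem_H10T_of_conjT_eq`: `x, y ∈ H10T`, `conjT y = x` ⇒ `x = 0`** — equality in the limit is equality at a finer level
  (`Module.DirectLimit.exists_eq_of_of_eq`), where it reads `conj (c_y h) = c_x h` componentwise with both classes in `F¹`; no injectivity of the
  transition maps is used.

The pin instance (records of record, `(datum413 …).HB τ' = Tower … V`, `rhoB τ' = act`) closing `stub_T2b_towerConjugationAt` verbatim is the
sequel `Theorems/P4StubT2bTowerConjugation.lean`.  HC_CM is proved only modulo the 7 printed citations until rung 0 closes; this file proves
nothing about them.  [cite: DeligneHodgeII1971, 1.2.5 and 2.1.4] [cite: VoisinHodgeI2002, §7.1] [cite: BorelWallach2000, VII 2.10]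

## References
* [DeligneHodgeII1971] P. Deligne, *Théorie de Hodge II*, Publ. Math. IHÉS 40 (1971), 1.2.5 (opposed filtrations), 2.1.4 (the real structure
  `conj ⊗ id` on `V_ℂ`).
* [VoisinHodgeI2002] C. Voisin, *Hodge Theory and Complex Algebraic Geometry I*, CUP 2002, §7.1 (`H^{p,q} = F^p ∩ conj F^q`, functoriality).
* [BorelWallach2000] A. Borel, N. Wallach, *Continuous cohomology, discrete subgroups, and representations of reductive groups*, 2nd ed.,
  AMS 2000, VII 2.10 (Hodge decomposition of the cohomology of compact locally symmetric varieties, complex conjugation exchanges `(p,q)`/`(q,p)`).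
* Tree: HodgeCM `Model/TowerLevel_1`, `_2` (`towerLevel`, `trPull`, `restrictLevel`, `castLevel`, `translate`, `res`), `Model/TowerCarrier`
  (`Tower`, `ofLevel`, `act`), `Model/Universe` (`universeOf_modelAxiomsPerL`), `Literature/AlgebraicGeometry/Motives/HodgeStructure`
  (`conj`, `complexConj`, `isCompl_F_complexConj`); Mathlib `Algebra/Colimit/Module` (`Module.DirectLimit.moduleCon`, `exists_eq_of_of_eq`).
-/

set_option autoImplicit false
set_option linter.dupNamespace false

noncomputable section

open Function Set
open Literature.AlgebraicGeometry.Motives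
open Literature.AlgebraicGeometry.ShimuraVarieties
open Literature.AlgebraicGeometry.HodgeTheory
open Literature.NumberTheory.Automorphic
open Literature.NumberTheory.Automorphic.PicardCM
open Literature.NumberTheory.Transcendental (Arapura2012_Cor_15_4_6)
open HodgeCM HodgeCM.Model HodgeCM.Model.LevelTranslate HodgeCM.Model.TowerLevel HodgeCM.Model.TowerCarrier

namespace Summit.HodgeConjecture.HodgeConjecture.Cruxes.H413.TowerConj

variable (hHD : exists_isReal_hodgeModel) (hI : hodgePQ_independent_of_hodgeModel)
  (hU : BallQuotientUniformisedDatum) (h₃ : CMAbelianVarietyRealised) (hA : Arapura2012_Cor_15_4_6)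
variable {L : CMField} {ι₁ : L →+* ℂ} {V : HermSpace3 L ι₁}

/-! ## §0 Conjugation passes through the rational translates `t_γ^*` and detects `F¹ ∩ conj F¹ = 0` -/

/-- `conj (t_γ^* x) = t_γ^* (conj x)`: the translates are base-changed `ℚ`-linear pull-backs. [cite: DeligneHodgeII1971, 2.1.4] -/
theorem conj_trPull (γ : ↥(Urat V)) (Δ₁ Δ₂ : Level V) (ht : TransCond (γ : GL (Fin 3) L) Δ₁ Δ₂) (k : ℕ)
    (x : Coh hHD hI hU h₃ Δ₂ k) :
    HodgeStructure.conj (trPull hHD hI hU h₃ hA γ Δ₁ Δ₂ ht k x) =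
      trPull hHD hI hU h₃ hA γ Δ₁ Δ₂ ht k (HodgeStructure.conj x) :=
  HodgeStructure.conj_baseChange _ _

/-- `t_γ^*` preserves the Hodge filtration (the model universe's `Fact_pull_hodge`). [cite: VoisinHodgeI2002, §7.1] -/
theorem trPull_mem_F (γ : ↥(Urat V)) (Δ₁ Δ₂ : Level V) (ht : TransCond (γ : GL (Fin 3) L) Δ₁ Δ₂) (p : ℤ)
    {x : Coh hHD hI hU h₃ Δ₂ 1}
    (hx : x ∈ ((universeOf hHD hI hU h₃).hodge ((universeOf hHD hI hU h₃).pms L ι₁ V Δ₂) 1).F p) :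
    trPull hHD hI hU h₃ hA γ Δ₁ Δ₂ ht 1 x ∈ ((universeOf hHD hI hU h₃).hodge ((universeOf hHD hI hU h₃).pms L ι₁ V Δ₁) 1).F p :=
  (universeOf_modelAxiomsPerL hHD hI hU h₃).pull_hodge _ _ _ 1 p (Submodule.mem_map_of_mem hx)

/-- In weight one, `F¹ ∩ conj F¹ = 0`: a class in `F¹` whose conjugate is also in `F¹` vanishes (opposedness of `F` and `conj F`).
[cite: DeligneHodgeII1971, 1.2.5] -/
theorem eq_zero_of_mem_F_one_of_conj_mem {W : Type} [AddCommGroup W] [Module ℚ W] (H : HodgeStructure W ((1 : ℕ) : ℤ))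
    {x : TensorProduct ℚ ℂ W} (hx : x ∈ H.F 1) (hcx : HodgeStructure.conj x ∈ H.F 1) : x = 0 := by
  have hc : IsCompl (H.F 1) (HodgeStructure.complexConj (H.F 1)) := H.isCompl_F_complexConj 1 1 (by norm_num)
  have hmem : x ∈ H.F 1 ⊓ HodgeStructure.complexConj (H.F 1) :=
    Submodule.mem_inf.mpr ⟨hx, HodgeStructure.mem_complexConj.mpr hcx⟩
  rw [hc.inf_eq_bot] at hmem
  exact (Submodule.mem_bot ℂ).mp hmem

/-! ## §1 Conjugation on the level carriers `H_K` -/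

section Level

variable (Γ : Level V) (hΓ : Γ.BelowConjThree)

/-- **Complex conjugation on `H_K`**: componentwise `conj ⊗ id` on `H¹(X_{Γ^h}; ℂ) = ℂ ⊗_ℚ H¹(X_{Γ^h}; ℚ)`; it preserves the defining
translation identities of `towerLevel` (`conj_trPull`) and is conjugate-linear. [cite: DeligneHodgeII1971, 2.1.4] -/
def conjL : towerLevel hHD hI hU h₃ hA Γ hΓ →ₛₗ[starRingEnd ℂ] towerLevel hHD hI hU h₃ hA Γ hΓ where
  toFun c := ⟨fun h ↦ HodgeStructure.conj ((c : Π h, W hHD hI hU h₃ Γ hΓ h) h),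
    (mem_towerLevel_iff hHD hI hU h₃ hA).mpr fun γ h h' r ↦ by
      show HodgeStructure.conj ((c : Π h, W hHD hI hU h₃ Γ hΓ h) h) =
        trPull hHD hI hU h₃ hA γ _ _ (transCond_of_rel hΓ r) 1 (HodgeStructure.conj ((c : Π h, W hHD hI hU h₃ Γ hΓ h) h'))
      rw [apply_eq_trPull hHD hI hU h₃ hA c r (transCond_of_rel hΓ r), conj_trPull]⟩
  map_add' c d := by
    ext h
    simp only [Submodule.coe_add, Pi.add_apply, map_add]
  map_smul' a c := by
    ext h
    simp only [Submodule.coe_smul, Pi.smul_apply, HodgeStructure.conj_smul]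

variable {Γ hΓ}

/-- Components of the conjugate family. -/
@[simp] theorem conjL_apply (c : towerLevel hHD hI hU h₃ hA Γ hΓ) (h : V.adelicFin) :
    (conjL hHD hI hU h₃ hA Γ hΓ c : Π h, W hHD hI hU h₃ Γ hΓ h) h =
      HodgeStructure.conj ((c : Π h, W hHD hI hU h₃ Γ hΓ h) h) := rfl

/-- `conjL` is an involution. [cite: DeligneHodgeII1971, 2.1.4] -/
@[simp] theorem conjL_conjL (c : towerLevel hHD hI hU h₃ hA Γ hΓ) :
    conjL hHD hI hU h₃ hA Γ hΓ (conjL hHD hI hU h₃ hA Γ hΓ c) = c := by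
  apply Subtype.ext; funext h
  simp only [conjL_apply, HodgeStructure.conj_conj]

/-- `conjL` is injective. -/
theorem conjL_injective : Function.Injective (conjL hHD hI hU h₃ hA Γ hΓ) :=
  Function.LeftInverse.injective (conjL_conjL hHD hI hU h₃ hA)

/-- `conjL` commutes with the change of level `Γ' ≤ Γ` (pull-back along the component coverings). -/
theorem restrictLevel_conjL {Γ Γ' : Level V} (hle : Γ' ≤ Γ) (hΓ : Γ.BelowConjThree) (hΓ' : Γ'.BelowConjThree)
    (c : towerLevel hHD hI hU h₃ hA Γ hΓ) :
    restrictLevel hHD hI hU h₃ hA hle hΓ hΓ' (conjL hHD hI hU h₃ hA Γ hΓ c) =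
      conjL hHD hI hU h₃ hA Γ' hΓ' (restrictLevel hHD hI hU h₃ hA hle hΓ hΓ' c) := by
  apply Subtype.ext; funext h
  simp only [restrictLevel_apply, conjL_apply, conj_trPull]

/-- `conjL` commutes with `castLevel` along an equality of levels. -/
theorem castLevel_conjL {Γ₁ Γ₂ : Level V} (e : Γ₁ = Γ₂) (hΓ₁ : Γ₁.BelowConjThree) (hΓ₂ : Γ₂.BelowConjThree)
    (c : towerLevel hHD hI hU h₃ hA Γ₁ hΓ₁) :
    castLevel hHD hI hU h₃ hA e hΓ₁ hΓ₂ (conjL hHD hI hU h₃ hA Γ₁ hΓ₁ c) =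
      conjL hHD hI hU h₃ hA Γ₂ hΓ₂ (castLevel hHD hI hU h₃ hA e hΓ₁ hΓ₂ c) :=
  restrictLevel_conjL hHD hI hU h₃ hA e.symm.le hΓ₁ hΓ₂ c

/-- `conjL` commutes with the re-indexing action `translate g : H_K → H_{gKg⁻¹}`. -/
theorem translate_conjL {Γ : Level V} (hΓ : Γ.BelowConjThree) (g : V.adelicFin) (c : towerLevel hHD hI hU h₃ hA Γ hΓ) :
    translate hHD hI hU h₃ hA hΓ g (conjL hHD hI hU h₃ hA Γ hΓ c) =
      conjL hHD hI hU h₃ hA (Γ.conj g hΓ) (hΓ.conj g) (translate hHD hI hU h₃ hA hΓ g c) := by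
  apply Subtype.ext; funext h
  simp only [translate_apply, conjL_apply, conj_trPull]

/-- `conjL` commutes with the restriction to the identity component. -/
theorem res_conjL {Γ : Level V} (hΓ : Γ.BelowConjThree) (c : towerLevel hHD hI hU h₃ hA Γ hΓ) :
    res hHD hI hU h₃ hA (conjL hHD hI hU h₃ hA Γ hΓ c) = HodgeStructure.conj (res hHD hI hU h₃ hA c) := by
  rw [res_apply, res_apply, conjL_apply, conj_trPull]

/-- **The `(1,0)`-families at level `Γ`**: the families all of whose components lie in `F¹H¹(X_{Γ^h}; ℂ)` (the inline `(1,0)`-part of the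
planner line, one level at a time). [cite: VoisinHodgeI2002, §7.1] -/
abbrev H10L (Γ : Level V) (hΓ : Γ.BelowConjThree) : Submodule ℂ (towerLevel hHD hI hU h₃ hA Γ hΓ) :=
  (Submodule.pi Set.univ fun h : V.adelicFin ↦
      ((universeOf hHD hI hU h₃).hodge ((universeOf hHD hI hU h₃).pms L ι₁ V (Γ.conj h hΓ)) 1).F 1).comap
    (towerLevel hHD hI hU h₃ hA Γ hΓ).subtype

/-- Membership in `H10L`: every component is in `F¹`. -/
theorem mem_H10L_iff {Γ : Level V} {hΓ : Γ.BelowConjThree} (c : towerLevel hHD hI hU h₃ hA Γ hΓ) :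
    c ∈ H10L hHD hI hU h₃ hA Γ hΓ ↔ ∀ h : V.adelicFin, (c : Π h, W hHD hI hU h₃ Γ hΓ h) h ∈
      ((universeOf hHD hI hU h₃).hodge ((universeOf hHD hI hU h₃).pms L ι₁ V (Γ.conj h hΓ)) 1).F 1 := by
  simp only [H10L, Submodule.mem_comap, Submodule.subtype_apply, Submodule.mem_pi, Set.mem_univ, true_implies]

/-- The change of level preserves `(1,0)`-families (`t_1^*` is a morphism of Hodge structures). [cite: VoisinHodgeI2002, §7.1] -/
theorem restrictLevel_mem_H10L {Γ Γ' : Level V} (hle : Γ' ≤ Γ) (hΓ : Γ.BelowConjThree) (hΓ' : Γ'.BelowConjThree)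
    {c : towerLevel hHD hI hU h₃ hA Γ hΓ} (hc : c ∈ H10L hHD hI hU h₃ hA Γ hΓ) :
    restrictLevel hHD hI hU h₃ hA hle hΓ hΓ' c ∈ H10L hHD hI hU h₃ hA Γ' hΓ' := by
  rw [mem_H10L_iff] at hc ⊢
  intro h
  rw [restrictLevel_apply]
  exact trPull_mem_F hHD hI hU h₃ hA 1 _ _ _ 1 (hc h)

/-- **Hodge-disjointness at one level**: a `(1,0)`-family whose conjugate is a `(1,0)`-family is zero. [cite: DeligneHodgeII1971, 1.2.5] -/
theorem eq_zero_of_mem_H10L_of_conjL_mem {Γ : Level V} {hΓ : Γ.BelowConjThree} {c : towerLevel hHD hI hU h₃ hA Γ hΓ}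
    (hc : c ∈ H10L hHD hI hU h₃ hA Γ hΓ) (hcc : conjL hHD hI hU h₃ hA Γ hΓ c ∈ H10L hHD hI hU h₃ hA Γ hΓ) : c = 0 := by
  rw [mem_H10L_iff] at hc hcc
  apply Subtype.ext; funext h
  rw [Submodule.coe_zero, Pi.zero_apply]
  exact eq_zero_of_mem_F_one_of_conj_mem _ (hc h) (by simpa only [conjL_apply] using hcc h)

end Level

/-! ## §2 Conjugation on the tower `H = colim_K H_K` -/

section Tower

variable (V)

/-- The additive map underlying `conjT`, from Mathlib's presentation of `Module.DirectLimit` as the quotient of the direct sum by the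
module congruence `DirectLimit.moduleCon`: the direct sum of the `ofLevel ∘ conjL` kills the generating relations because `conjL`
commutes with the transitions (`restrictLevel_conjL`). -/
def conjTAddHom : Tower hHD hI hU h₃ hA V →+ Tower hHD hI hU h₃ hA V :=
  AddCon.lift (Module.DirectLimit.moduleCon (towerSystem hHD hI hU h₃ hA V)).toAddCon
    (DirectSum.toAddMonoid fun i : TLvl V ↦
      ((ofLevel hHD hI hU h₃ hA i.1 i.2).toAddMonoidHom).comp (conjL hHD hI hU h₃ hA i.1 i.2).toAddMonoidHom)
    (by
      change addConGen (Module.DirectLimit.Eqv (towerSystem hHD hI hU h₃ hA V)) ≤ _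
      refine AddCon.addConGen_le.2 ?_
      rintro _ _ ⟨hij, x⟩
      rw [AddCon.ker_rel, DirectSum.lof_eq_of, DirectSum.lof_eq_of, DirectSum.toAddMonoid_of, DirectSum.toAddMonoid_of]
      change ofLevel hHD hI hU h₃ hA _ _ (conjL hHD hI hU h₃ hA _ _ x) =
        ofLevel hHD hI hU h₃ hA _ _ (conjL hHD hI hU h₃ hA _ _ (restrictLevel hHD hI hU h₃ hA (TLvl.le_def.mp hij) _ _ x))
      rw [← restrictLevel_conjL, ofLevel_restrictLevel])

variable {V}

/-- The additive map on the image of a level. -/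
theorem conjTAddHom_ofLevel (Γ : Level V) (hΓ : Γ.BelowConjThree) (c : towerLevel hHD hI hU h₃ hA Γ hΓ) :
    conjTAddHom hHD hI hU h₃ hA V (ofLevel hHD hI hU h₃ hA Γ hΓ c) =
      ofLevel hHD hI hU h₃ hA Γ hΓ (conjL hHD hI hU h₃ hA Γ hΓ c) := by
  change (DirectSum.toAddMonoid fun i : TLvl V ↦
      ((ofLevel hHD hI hU h₃ hA i.1 i.2).toAddMonoidHom).comp (conjL hHD hI hU h₃ hA i.1 i.2).toAddMonoidHom)
    (DirectSum.lof ℂ (TLvl V) (HK hHD hI hU h₃ hA V) (TLvl.mk Γ hΓ) c) = _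
  rw [DirectSum.lof_eq_of, DirectSum.toAddMonoid_of]
  rfl

variable (V)

/-- **Complex conjugation on the tower** `H = colim_K H¹(X_K(ℂ); ℂ)`: the conjugate-linear endomorphism induced by the `conjL`.
[cite: DeligneHodgeII1971, 2.1.4] [cite: BorelWallach2000, VII 2.10] -/
def conjT : Tower hHD hI hU h₃ hA V →ₛₗ[starRingEnd ℂ] Tower hHD hI hU h₃ hA V where
  toFun := conjTAddHom hHD hI hU h₃ hA V
  map_add' x y := map_add _ x y
  map_smul' a x := by
    induction x using Module.DirectLimit.induction_on with
    | ih i c =>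
      change conjTAddHom hHD hI hU h₃ hA V (a • ofLevel hHD hI hU h₃ hA i.1 i.2 c) =
        starRingEnd ℂ a • conjTAddHom hHD hI hU h₃ hA V (ofLevel hHD hI hU h₃ hA i.1 i.2 c)
      have h1 : a • ofLevel hHD hI hU h₃ hA i.1 i.2 c = ofLevel hHD hI hU h₃ hA i.1 i.2 (a • c) := (map_smul _ a c).symm
      rw [h1, conjTAddHom_ofLevel, conjTAddHom_ofLevel, map_smulₛₗ, map_smul]

variable {V}

/-- **`conjT ∘ ofLevel = ofLevel ∘ conjL`.** -/
@[simp] theorem conjT_ofLevel (Γ : Level V) (hΓ : Γ.BelowConjThree) (c : towerLevel hHD hI hU h₃ hA Γ hΓ) :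
    conjT hHD hI hU h₃ hA V (ofLevel hHD hI hU h₃ hA Γ hΓ c) = ofLevel hHD hI hU h₃ hA Γ hΓ (conjL hHD hI hU h₃ hA Γ hΓ c) :=
  conjTAddHom_ofLevel hHD hI hU h₃ hA Γ hΓ c

/-- `conjT` is an involution. [cite: DeligneHodgeII1971, 2.1.4] -/
@[simp] theorem conjT_conjT (x : Tower hHD hI hU h₃ hA V) :
    conjT hHD hI hU h₃ hA V (conjT hHD hI hU h₃ hA V x) = x := by
  obtain ⟨Γ, hΓ, c, rfl⟩ := exists_ofLevel hHD hI hU h₃ hA x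
  rw [conjT_ofLevel, conjT_ofLevel, conjL_conjL]

/-- `conjT` is injective. -/
theorem conjT_injective : Function.Injective (conjT hHD hI hU h₃ hA V) :=
  Function.LeftInverse.injective (conjT_conjT hHD hI hU h₃ hA)

/-- **`conjT` commutes with the Hecke action** `act g` of `g ∈ U(V)(𝔸_f)` (re-indexing is componentwise `t_1^*`).
[cite: BorelWallach2000, VII 2.10] -/
theorem conjT_act (g : V.adelicFin) (x : Tower hHD hI hU h₃ hA V) :
    conjT hHD hI hU h₃ hA V (act hHD hI hU h₃ hA g x) = act hHD hI hU h₃ hA g (conjT hHD hI hU h₃ hA V x) := by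
  obtain ⟨Γ, hΓ, c, rfl⟩ := exists_ofLevel hHD hI hU h₃ hA x
  rw [act_ofLevel, conjT_ofLevel, conjT_ofLevel, act_ofLevel, translate_conjL]

/-- `conjT` commutes with the representation `towerRep`. -/
theorem conjT_towerRep (g : V.adelicFin) (x : Tower hHD hI hU h₃ hA V) :
    conjT hHD hI hU h₃ hA V (towerRep hHD hI hU h₃ hA V g x) = towerRep hHD hI hU h₃ hA V g (conjT hHD hI hU h₃ hA V x) :=
  conjT_act hHD hI hU h₃ hA g x

end Tower

/-! ## §3 The `(1,0)`-part of the tower and its Hodge-disjointness from its conjugate -/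

section H10

variable (V)

/-- **The `(1,0)`-part of the tower**: the span of the `ofLevel`-images of the `(1,0)`-families of all levels (the planner line's inline term).
[cite: VoisinHodgeI2002, §7.1] -/
abbrev H10T : Submodule ℂ (Tower hHD hI hU h₃ hA V) :=
  ⨆ j : TLvl V, (H10L hHD hI hU h₃ hA j.1 j.2).map (ofLevel hHD hI hU h₃ hA j.1 j.2)

/-- The level pieces of `H10T` increase along the tower (`ofLevel Γ c = ofLevel Γ' (restrictLevel c)` and `restrictLevel` preserves `F¹`). -/
theorem H10T_mono : Monotone fun j : TLvl V ↦ (H10L hHD hI hU h₃ hA j.1 j.2).map (ofLevel hHD hI hU h₃ hA j.1 j.2) := by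
  intro i j hij x hx
  obtain ⟨c, hc, rfl⟩ := Submodule.mem_map.mp hx
  exact Submodule.mem_map.mpr ⟨restrictLevel hHD hI hU h₃ hA (TLvl.le_def.mp hij) i.2 j.2 c,
    restrictLevel_mem_H10L hHD hI hU h₃ hA (TLvl.le_def.mp hij) i.2 j.2 hc,
    ofLevel_restrictLevel hHD hI hU h₃ hA (TLvl.le_def.mp hij) i.2 j.2 c⟩

/-- Membership in `H10T`: being the image of a `(1,0)`-family of SOME level (the union is directed). -/
theorem mem_H10T_iff (x : Tower hHD hI hU h₃ hA V) :
    x ∈ H10T hHD hI hU h₃ hA V ↔ ∃ (j : TLvl V) (c : towerLevel hHD hI hU h₃ hA j.1 j.2),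
      c ∈ H10L hHD hI hU h₃ hA j.1 j.2 ∧ ofLevel hHD hI hU h₃ hA j.1 j.2 c = x := by
  refine (Submodule.mem_iSup_of_directed _ (H10T_mono hHD hI hU h₃ hA V).directed_le).trans ?_
  constructor
  · rintro ⟨j, hx⟩
    obtain ⟨c, hc, rfl⟩ := Submodule.mem_map.mp hx
    exact ⟨j, c, hc, rfl⟩
  · rintro ⟨j, c, hc, rfl⟩
    exact ⟨j, Submodule.mem_map_of_mem hc⟩

variable {V}

/-- **Hodge-disjointness on the tower: `x, y ∈ H10T`, `conjT y = x` ⇒ `x = 0`** (`H10T ∩ conjT H10T = 0`).  At a common level the identity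
reads, after one more transition (`Module.DirectLimit.exists_eq_of_of_eq`), `conj (c_y h) = c_x h` with both classes in `F¹H¹(X_{Γ^h})`, and
`F¹ ∩ conj F¹ = 0` in weight one. [cite: DeligneHodgeII1971, 1.2.5] [cite: VoisinHodgeI2002, §7.1] -/
theorem eq_zero_of_mem_H10T_of_conjT_eq {x y : Tower hHD hI hU h₃ hA V} (hx : x ∈ H10T hHD hI hU h₃ hA V)
    (hy : y ∈ H10T hHD hI hU h₃ hA V) (hyx : conjT hHD hI hU h₃ hA V y = x) : x = 0 := by
  obtain ⟨i, cx, hcx, rfl⟩ := (mem_H10T_iff hHD hI hU h₃ hA V x).mp hx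
  obtain ⟨i', cy, hcy, rfl⟩ := (mem_H10T_iff hHD hI hU h₃ hA V y).mp hy
  -- a common level `k`
  obtain ⟨k, hik, hi'k⟩ := exists_ge_ge i i'
  set cx' := restrictLevel hHD hI hU h₃ hA (TLvl.le_def.mp hik) i.2 k.2 cx
  set cy' := restrictLevel hHD hI hU h₃ hA (TLvl.le_def.mp hi'k) i'.2 k.2 cy
  have hx' : ofLevel hHD hI hU h₃ hA i.1 i.2 cx = ofLevel hHD hI hU h₃ hA k.1 k.2 cx' :=
    (ofLevel_restrictLevel hHD hI hU h₃ hA (TLvl.le_def.mp hik) i.2 k.2 cx).symm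
  have hy' : ofLevel hHD hI hU h₃ hA i'.1 i'.2 cy = ofLevel hHD hI hU h₃ hA k.1 k.2 cy' :=
    (ofLevel_restrictLevel hHD hI hU h₃ hA (TLvl.le_def.mp hi'k) i'.2 k.2 cy).symm
  have hcx' : cx' ∈ H10L hHD hI hU h₃ hA k.1 k.2 := restrictLevel_mem_H10L hHD hI hU h₃ hA _ _ _ hcx
  have hcy' : cy' ∈ H10L hHD hI hU h₃ hA k.1 k.2 := restrictLevel_mem_H10L hHD hI hU h₃ hA _ _ _ hcy
  rw [hx', hy', conjT_ofLevel] at hyx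
  rw [hx']
  -- equality in the limit is equality after one more transition
  obtain ⟨l, hkl, hl⟩ := Module.DirectLimit.exists_eq_of_of_eq hyx
  change restrictLevel hHD hI hU h₃ hA (TLvl.le_def.mp hkl) k.2 l.2 (conjL hHD hI hU h₃ hA k.1 k.2 cy') =
    restrictLevel hHD hI hU h₃ hA (TLvl.le_def.mp hkl) k.2 l.2 cx' at hl
  rw [restrictLevel_conjL] at hl
  have hzero : restrictLevel hHD hI hU h₃ hA (TLvl.le_def.mp hkl) k.2 l.2 cx' = 0 := by
    refine eq_zero_of_mem_H10L_of_conjL_mem hHD hI hU h₃ hA (restrictLevel_mem_H10L hHD hI hU h₃ hA _ _ _ hcx') ?_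
    rw [← hl, conjL_conjL]
    exact restrictLevel_mem_H10L hHD hI hU h₃ hA _ _ _ hcy'
  rw [← ofLevel_restrictLevel hHD hI hU h₃ hA (TLvl.le_def.mp hkl) k.2 l.2 cx', hzero, map_zero]

end H10

end Summit.HodgeConjecture.HodgeConjecture.Cruxes.H413.TowerConj

end
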